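import Mathlib
import Summits.ValiantsHypothesis.ValiantsHypothesis.Theses.NewtonUnitEquations
import Literature.Computability.AlgebraicComplexity.NewtonPolygonTauTransfer
import Summits.ValiantsHypothesis.ValiantsHypothesis.Theorems.TwoProducts.Negative.LoadBearing

/-!
# `TwoProducts` (stmt-ValiantsHypothesis-5906) — negative side: the no-internal-cancellation hypothesis of
# obstruction F8 (`Negative/FirstOrderExposure.lean`) is load-bearing: a certified ORDER-TWO ("deep") vertex

Standing disprover (cdisprove, cycle 2).  `FirstOrderExposure.lean` proves: if the support of `∏ f_j` is the full
Minkowski sum of the supports (no internal cancellation), every vertex of `Newt(∏ f_j − const)` that is not a vertex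
of `Newt(∏ f_j)` is a FIRST-ORDER point (an element of some `supp f_j`).  Here we certify that the hypothesis cannot
be dropped, with the smallest design of KPTT's Appendix type (`m = 2`, `t = 3`, `g ≡ 1`):

  `f₀ = 1 + XY + X⁵`,  `f₁ = 1 − XY + Y⁵`,  `f₀f₁ − 1 = X⁵ + Y⁵ − X²Y² + XY⁶ − X⁶Y + X⁵Y⁵`.

The first-order points `XY` cancel inside the product, and the second-order point `X²Y² = (XY)·(XY)` becomes a
vertex of `Newt(f₀f₁ − 1)` (strictly exposed by `−(x+y)`: every other support point has `x + y ≥ 5`), although it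
is not a vertex of `Newt(f₀f₁)` (it is the midpoint of `(4,0), (0,4) ∈ conv{0, (5,0), (0,5)}`) and lies in no
`supp f_j`.  So "exposed ⇒ first order" (and with it every accounting that charges new vertices to first-order
monomials structurally) genuinely needs the cancellation-freeness; what survives conjecturally is only the COUNT
(`FirstOrderCount`, Disproof.lean §3/F9: here 3 south-west vertices `(5,0),(2,2),(0,5)` against 4 first-order
monomials).  [cite: KoiranPortierTavenasThomasse2015, Appendix (example `fg+1 = 2X³Y³ − ¼(X⁴Y⁸+2X⁶Y⁶+X⁸Y⁴)`)]
-/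

set_option linter.dupNamespace false

open scoped BigOperators Pointwise

namespace Summit.ValiantsHypothesis.ValiantsHypothesis.Theorems.TwoProducts.Negative

open MvPolynomial Literature.Computability.AlgebraicComplexity

noncomputable section

/-- The monomial `X^a Y^b` with coefficient `1` (a helper `abbrev`, not a fact). -/
abbrev mXY (a b : ℕ) : MvPolynomial (Fin 2) ℂ := monomial (ex a b) 1

/-- `X^aY^b · X^cY^d = X^{a+c}Y^{b+d}`. [folklore] -/
theorem mXY_mul (a b c d : ℕ) : mXY a b * mXY c d = mXY (a + c) (b + d) := by
  simp [mXY, monomial_mul, ex_add]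

/-- `ex a b = ex c d ↔ a = c ∧ b = d`. [folklore] -/
@[simp] theorem ex_eq_ex_iff (a b c d : ℕ) : ex a b = ex c d ↔ a = c ∧ b = d :=
  ⟨ex_injective2, fun ⟨h1, h2⟩ => by rw [h1, h2]⟩

/-- `ex 0 0 = 0`. [folklore] -/
theorem ex_zero_zero : ex 0 0 = 0 := by
  ext i; fin_cases i <;> simp

/-- `ex a b = 0 ↔ a = 0 ∧ b = 0`. [folklore] -/
@[simp] theorem ex_eq_zero_iff (a b : ℕ) : ex a b = 0 ↔ a = 0 ∧ b = 0 := by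
  rw [← ex_zero_zero, ex_eq_ex_iff]

/-- `0 = ex a b ↔ a = 0 ∧ b = 0`. [folklore] -/
@[simp] theorem zero_eq_ex_iff (a b : ℕ) : (0 : Fin 2 →₀ ℕ) = ex a b ↔ a = 0 ∧ b = 0 := by
  rw [eq_comm, ex_eq_zero_iff]

/-- The first factor `f₀ = 1 + XY + X⁵` of the deep-vertex design (a definition, not a fact). -/
def dvF₀ : MvPolynomial (Fin 2) ℂ := 1 + mXY 1 1 + mXY 5 0

/-- The second factor `f₁ = 1 − XY + Y⁵` of the deep-vertex design (a definition, not a fact). -/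
def dvF₁ : MvPolynomial (Fin 2) ℂ := 1 - mXY 1 1 + mXY 0 5

/-- The design as a `Fin 2`-family (a definition, not a fact). -/
def dvF : Fin 2 → MvPolynomial (Fin 2) ℂ := ![dvF₀, dvF₁]

/-- `∏ dvF = f₀ f₁`. [folklore] -/
theorem prod_dvF : ∏ j, dvF j = dvF₀ * dvF₁ := by
  rw [Fin.prod_univ_two]; rfl

/-- THE IDENTITY: `f₀f₁ − 1 = X⁵ + Y⁵ − X²Y² + XY⁶ − X⁶Y + X⁵Y⁵` (the `XY` terms cancel). [folklore] -/
theorem dvW_eq : dvF₀ * dvF₁ - 1 =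
    mXY 5 0 + mXY 0 5 - mXY 2 2 + mXY 1 6 - mXY 6 1 + mXY 5 5 := by
  simp only [dvF₀, dvF₁, add_mul, mul_add, mul_sub, one_mul, mul_one, mXY_mul]
  ring

/-- The product itself: `f₀f₁ = 1 + X⁵ + Y⁵ − X²Y² + XY⁶ − X⁶Y + X⁵Y⁵`. [folklore] -/
theorem dvP_eq : dvF₀ * dvF₁ =
    1 + (mXY 5 0 + mXY 0 5 - mXY 2 2 + mXY 1 6 - mXY 6 1 + mXY 5 5) := by
  rw [← dvW_eq]; ring

/-- Coefficient table of `f₀f₁ − 1` at `X^aY^b`. [folklore] -/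
theorem coeff_dvW (a b : ℕ) : coeff (ex a b) (dvF₀ * dvF₁ - 1) =
    (if ex 5 0 = ex a b then 1 else 0) + (if ex 0 5 = ex a b then 1 else 0) -
      (if ex 2 2 = ex a b then 1 else 0) + (if ex 1 6 = ex a b then 1 else 0) -
      (if ex 6 1 = ex a b then 1 else 0) + (if ex 5 5 = ex a b then 1 else 0) := by
  rw [dvW_eq]
  simp only [coeff_add, coeff_sub, mXY, coeff_monomial]

/-- The deep point `X²Y²` has coefficient `−1` in `f₀f₁ − 1`. [folklore] -/
theorem coeff_dvW_22 : coeff (ex 2 2) (dvF₀ * dvF₁ - 1) = -1 := by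
  rw [coeff_dvW]
  simp

/-- Every support point of `f₀f₁ − 1` other than `X²Y²` has `x + y ≥ 5`. [folklore] -/
theorem five_le_of_mem_support_dvW {e : Fin 2 →₀ ℕ} (he : e ∈ (dvF₀ * dvF₁ - 1).support)
    (hne : e ≠ ex 2 2) : 5 ≤ e 0 + e 1 := by
  by_contra hlt
  push Not at hlt
  rw [ex_eq e] at he hne
  have h1 : ¬ (5 = e 0 ∧ 0 = e 1) := by omega
  have h2 : ¬ (0 = e 0 ∧ 5 = e 1) := by omega
  have h3 : ¬ (2 = e 0 ∧ 2 = e 1) := fun h => hne (by rw [← h.1, ← h.2])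
  have h4 : ¬ (1 = e 0 ∧ 6 = e 1) := by omega
  have h5 : ¬ (6 = e 0 ∧ 1 = e 1) := by omega
  have h6 : ¬ (5 = e 0 ∧ 5 = e 1) := by omega
  rw [mem_support_iff, coeff_dvW] at he
  simp [h1, h2, h3, h4, h5, h6] at he

/-- Coefficient table of the product `f₀f₁` at `X^aY^b`. [folklore] -/
theorem coeff_dvP (a b : ℕ) : coeff (ex a b) (dvF₀ * dvF₁) =
    (if (0 : Fin 2 →₀ ℕ) = ex a b then 1 else 0) +
    ((if ex 5 0 = ex a b then 1 else 0) + (if ex 0 5 = ex a b then 1 else 0) -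
      (if ex 2 2 = ex a b then 1 else 0) + (if ex 1 6 = ex a b then 1 else 0) -
      (if ex 6 1 = ex a b then 1 else 0) + (if ex 5 5 = ex a b then 1 else 0)) := by
  rw [dvP_eq]
  simp only [coeff_add, coeff_sub, mXY, coeff_monomial, coeff_one]

/-- `0`, `(5,0)` and `(0,5)` are support points of the product `f₀f₁`. [folklore] -/
theorem mem_support_dvP :
    (0 : Fin 2 →₀ ℕ) ∈ (dvF₀ * dvF₁).support ∧ ex 5 0 ∈ (dvF₀ * dvF₁).support ∧
      ex 0 5 ∈ (dvF₀ * dvF₁).support := by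
  refine ⟨?_, ?_, ?_⟩
  · rw [← ex_zero_zero, mem_support_iff, coeff_dvP]
    simp
  · rw [mem_support_iff, coeff_dvP]
    simp
  · rw [mem_support_iff, coeff_dvP]
    simp

/-- `X²Y²` is in neither factor's support (it is a second-order point `XY·XY`). [folklore] -/
theorem ex22_notMem_support_dvF (j : Fin 2) : ex 2 2 ∉ (dvF j).support := by
  fin_cases j
  · simp [dvF, dvF₀, mXY, coeff_one, coeff_monomial]
  · simp [dvF, dvF₁, mXY, coeff_one, coeff_monomial]

/-- Each factor is `3`-sparse. [folklore] -/
theorem card_support_dvF (j : Fin 2) : (dvF j).support.card ≤ 3 := by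
  classical
  have hm : ∀ a b : ℕ, (mXY a b).support.card ≤ 1 := fun a b =>
    (Finset.card_le_card support_monomial_subset).trans (by simp)
  have h1 : (1 : MvPolynomial (Fin 2) ℂ).support.card ≤ 1 := by
    rw [support_one]; simp
  have hadd : ∀ p q : MvPolynomial (Fin 2) ℂ, (p + q).support.card ≤ p.support.card + q.support.card :=
    fun p q => (Finset.card_le_card support_add).trans (Finset.card_union_le _ _)
  have hsub : ∀ p q : MvPolynomial (Fin 2) ℂ, (p - q).support.card ≤ p.support.card + q.support.card :=
    fun p q => by
      rw [sub_eq_add_neg]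
      exact (hadd p (-q)).trans (by rw [support_neg])
  fin_cases j
  · show (dvF₀).support.card ≤ 3
    unfold dvF₀
    calc (1 + mXY 1 1 + mXY 5 0).support.card ≤ (1 + mXY 1 1).support.card + (mXY 5 0).support.card := hadd _ _
      _ ≤ ((1 : MvPolynomial (Fin 2) ℂ).support.card + (mXY 1 1).support.card) + (mXY 5 0).support.card :=
          Nat.add_le_add_right (hadd _ _) _
      _ ≤ (1 + 1) + 1 := Nat.add_le_add (Nat.add_le_add h1 (hm 1 1)) (hm 5 0)
  · show (dvF₁).support.card ≤ 3
    unfold dvF₁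
    calc (1 - mXY 1 1 + mXY 0 5).support.card ≤ (1 - mXY 1 1).support.card + (mXY 0 5).support.card := hadd _ _
      _ ≤ ((1 : MvPolynomial (Fin 2) ℂ).support.card + (mXY 1 1).support.card) + (mXY 0 5).support.card :=
          Nat.add_le_add_right (hsub _ _) _
      _ ≤ (1 + 1) + 1 := Nat.add_le_add (Nat.add_le_add h1 (hm 1 1)) (hm 0 5)

/-- Constant terms are `1`. [folklore] -/
theorem coeff_zero_dvF (j : Fin 2) : coeff 0 (dvF j) = 1 := by
  fin_cases j
  · simp [dvF, dvF₀, mXY, coeff_monomial]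
  · simp [dvF, dvF₁, mXY, coeff_monomial]

/-- The exposing functional `(x, y) ↦ −(x + y)` (a definition, not a fact). -/
def negSum : (Fin 2 → ℝ) →ₗ[ℝ] ℝ where
  toFun q := -(q 0 + q 1)
  map_add' q q' := by simp only [Pi.add_apply]; ring
  map_smul' c q := by simp only [Pi.smul_apply, smul_eq_mul, RingHom.id_apply]; ring

/-- `negSum` evaluated. [folklore] -/
@[simp] theorem negSum_apply (q : Fin 2 → ℝ) : negSum q = -(q 0 + q 1) := rfl

/-- **`X²Y²` IS a vertex of `Newt(f₀f₁ − 1)`** (strictly exposed by `−(x+y)`). [folklore] -/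
theorem ex22_mem_extremePoints_dvW :
    ι (ex 2 2) ∈ (convexHull ℝ (ι '' ((dvF₀ * dvF₁ - 1).support : Set (Fin 2 →₀ ℕ)))).extremePoints ℝ := by
  have hp : ι (ex 2 2) ∈ ι '' ((dvF₀ * dvF₁ - 1).support : Set (Fin 2 →₀ ℕ)) :=
    ⟨ex 2 2, by rw [Finset.mem_coe, mem_support_iff, coeff_dvW_22]; norm_num, rfl⟩
  refine KPTT.mem_extremePoints_convexHull_of_linear hp negSum ?_
  rintro q ⟨e, he, rfl⟩ hne
  have hne' : e ≠ ex 2 2 := fun h => hne (by rw [h])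
  have h5 := five_le_of_mem_support_dvW (Finset.mem_coe.1 he) hne'
  have h5' : (5 : ℝ) ≤ (e 0 : ℝ) + (e 1 : ℝ) := by exact_mod_cast h5
  simp only [negSum_apply, ι, ex_apply_zero, ex_apply_one]
  push_cast
  linarith

/-- **`X²Y²` is NOT a vertex of `Newt(f₀f₁)`**: it is the midpoint of `(4,0)` and `(0,4)`, both in the hull of the
support points `0, (5,0), (0,5)` of the product. [folklore] -/
theorem ex22_notMem_extremePoints_dvP :
    ι (ex 2 2) ∉ (convexHull ℝ (ι '' ((dvF₀ * dvF₁).support : Set (Fin 2 →₀ ℕ)))).extremePoints ℝ := by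
  set S : Set (Fin 2 → ℝ) := ι '' ((dvF₀ * dvF₁).support : Set (Fin 2 →₀ ℕ)) with hS
  obtain ⟨h0, h50, h05⟩ := mem_support_dvP
  have m0 : ι 0 ∈ S := ⟨0, Finset.mem_coe.2 h0, rfl⟩
  have m50 : ι (ex 5 0) ∈ S := ⟨ex 5 0, Finset.mem_coe.2 h50, rfl⟩
  have m05 : ι (ex 0 5) ∈ S := ⟨ex 0 5, Finset.mem_coe.2 h05, rfl⟩
  -- the two auxiliary hull points a = (4,0), b = (0,4)
  set a : Fin 2 → ℝ := ![4, 0] with ha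
  set b : Fin 2 → ℝ := ![0, 4] with hb
  have haS : a ∈ convexHull ℝ S := by
    refine (convex_convexHull ℝ S).segment_subset (subset_convexHull ℝ S m0) (subset_convexHull ℝ S m50) ?_
    refine ⟨1 / 5, 4 / 5, by norm_num, by norm_num, by norm_num, ?_⟩
    ext i; fin_cases i <;> norm_num [ha, ι]
  have hbS : b ∈ convexHull ℝ S := by
    refine (convex_convexHull ℝ S).segment_subset (subset_convexHull ℝ S m0) (subset_convexHull ℝ S m05) ?_
    refine ⟨1 / 5, 4 / 5, by norm_num, by norm_num, by norm_num, ?_⟩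
    ext i; fin_cases i <;> norm_num [hb, ι]
  have hseg : ι (ex 2 2) ∈ openSegment ℝ a b := by
    refine ⟨1 / 2, 1 / 2, by norm_num, by norm_num, by norm_num, ?_⟩
    ext i; fin_cases i <;> norm_num [ha, hb, ι]
  intro hext
  rw [mem_extremePoints] at hext
  have := (hext.2 a haS b hbS hseg).1
  have h4 : a 1 = ι (ex 2 2) 1 := by rw [this]
  simp [ha, ι] at h4

/-- **F8's hypothesis is load-bearing (a certified deep vertex).**  There are two `3`-sparse bivariate factors with
constant terms `1` and an exponent `e` such that `e` is a vertex of `Newt(∏ f_j − 1)`, is NOT a vertex of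
`Newt(∏ f_j)`, and lies in NO `supp f_j` — so the conclusion of `extremePoint_sdiff_zero_of_sum` /
`newtonVertexCount_sub_const_le_of_support_eq_sum`'s mechanism ("cancelling the constant exposes only first-order
points") fails as soon as the product has internal cancellation.  Witness: `f₀ = 1 + XY + X⁵`, `f₁ = 1 − XY + Y⁵`,
`e = (2,2)`. [cite: KoiranPortierTavenasThomasse2015, Appendix] -/
theorem exists_deep_vertex_with_internal_cancellation :
    ∃ f : Fin 2 → MvPolynomial (Fin 2) ℂ, (∀ j, (f j).support.card ≤ 3) ∧ (∀ j, coeff 0 (f j) = 1) ∧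
      ∃ e : Fin 2 →₀ ℕ,
        ι e ∈ (convexHull ℝ (ι '' ((∏ j, f j - 1).support : Set (Fin 2 →₀ ℕ)))).extremePoints ℝ ∧
        ι e ∉ (convexHull ℝ (ι '' ((∏ j, f j).support : Set (Fin 2 →₀ ℕ)))).extremePoints ℝ ∧
        ∀ j, e ∉ (f j).support :=
  ⟨dvF, card_support_dvF, coeff_zero_dvF, ex 2 2, by rw [prod_dvF]; exact ex22_mem_extremePoints_dvW,
    by rw [prod_dvF]; exact ex22_notMem_extremePoints_dvP, ex22_notMem_support_dvF⟩

/-- Corollary in the language of F8: for this design the support of the product is NOT the Minkowski sum of the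
supports (the point `XY = XY + 0` of the sumset is cancelled), i.e. the hypothesis `hsupp` of
`newtonVertexCount_sub_const_le_of_support_eq_sum` fails — consistent with, and explained by, the theorem above.
[folklore] -/
theorem support_prod_dvF_ne_sum : (∏ j, dvF j).support ≠ ∑ j, (dvF j).support := by
  classical
  rw [prod_dvF, Fin.sum_univ_two]
  intro h
  -- `ex 1 1 ∈ supp f₀ + supp f₁` (as `ex 1 1 + 0`) but its coefficient in the product is 0
  have h11 : ex 1 1 ∈ (dvF 0).support := by
    simp [dvF, dvF₀, mXY, coeff_one, coeff_monomial]
  have h0' : (0 : Fin 2 →₀ ℕ) ∈ (dvF 1).support := by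
    rw [mem_support_iff, coeff_zero_dvF]; exact one_ne_zero
  have hmem : ex 1 1 ∈ (dvF 0).support + (dvF 1).support :=
    Finset.mem_add.2 ⟨ex 1 1, h11, 0, h0', add_zero _⟩
  rw [← h, mem_support_iff, coeff_dvP] at hmem
  simp at hmem

end

end Summit.ValiantsHypothesis.ValiantsHypothesis.Theorems.TwoProducts.Negative
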